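import Summits.QuantumFields.QCD.Theorems.NestedDissectionSeaLightQuarkCompletionBandPinsOfCorner

/-!
# Crux `LightQuarkCompletion` (stmt-QuantumFields-18066) — line `Sketch` rev 6: the ONE child of composition B,
# `ChiralCornerPinnedExists`, written in the ROUTE FILE'S vocabulary, with a machine-checked equivalence to the
# registered stub `LightQuarkJumpLine.stub_chiralCornerPinnedExists`

Lead workfile (prover-line-stmt-QuantumFields-18066-c4-0, cycle 4, 2026-08-17).  NOT a Theorems proposal (it declares a
`def … : Prop`, the candidate child statement); published to the crux directory for the planner.

`ChiralCornerPinnedExistsRaw` below is the text a planner can paste as a Theses item (it mentions only Literature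
vocabulary and the crux's own clauses: no `HypAt`/`Body`/`PinPkg`/`upShift` abbreviation).  Reading: for `N_f ∈ {2,3}` and
every regularisation `reg` carrying the crux's threshold package at `M₀` (both scalings, weak branch, `0 ≤ M₀`, the two-sided
parity pin above `M₀`, the `QCDOf` body above `M₀` — hypotheses 1–6 of `LightQuarkCompletion` VERBATIM), IF some constant RGI
re-pin `δ` of the critical mass makes the δ-re-pinned schemes `reg.scheme (fun f => m f + δ)` chiral at zero and carry the
body at every positive tuple (= the conclusion of the sibling item `HeavyThresholdYMBridge.ChiralCompletion`, stmt-17661,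
VERBATIM), THEN some such `δ` also carries the two-sided parity pin at ZERO threshold: for every positive sea tuple `m` some
`R > 0` with, for every `M > 0`, eventually in `k`, `P(Re det D_W(m_crit + a(δ − M)/Z_m) < 0) ≥ 1/4` on odd tori of side `≥ R`
and `P(Re det D_W(m_crit + a(δ + M)/Z_m) < 0) ≤ 1/8` on odd tori of side in `[R, 2R]`, phase-quenched weight at the sea tuple
`m + δ` (the crux's conclusion clause 4 for `reg' = reg` re-pinned by `δ`).

`chiralCornerPinnedExistsRaw_iff_stub` certifies that this text IS the registered stub (the Theorems-side abbreviations
unfolded; the only non-definitional steps are `reg.scheme (m + δ) = (upShift reg δ).scheme m` and the re-bracketing of the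
pinned bare masses `m_crit + aδ/Z_m ∓ aM/Z_m = m_crit + a(δ ∓ M)/Z_m`, `(m_crit + aδ/Z_m) + a m_f/Z_m = m_crit + a(m_f + δ)/Z_m`).
With the child filed as a Theses decl `C`, the line closes the crux by `lightQuarkCompletion_of_chiralCornerPinnedExists
stub_frame stub_chiralCompletion17661 (chiralCornerPinnedExistsRaw_iff_stub.1 C)` — items 17012 + 17661 (or 18327 ∧ 18328) + C.
-/

noncomputable section

namespace Summit.QuantumFields.QCD.Theorems.LightQuarkJumpLine

open MeasureTheory Filter Topology
open Literature.MathematicalPhysics.QuantumFieldTheory Literature.MathematicalPhysics.QuantumLattice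
  Literature.Probability.LatticeModels
open Summit.QuantumFields.QCD.Theorems.CoerciveSeaNegative (PinClause)
open Summit.QuantumFields.QCD.Theorems.EarlyCrosserLawNegative (UpperPin)
open Summit.QuantumFields.QCD.Theorems.LightQuarkCompletion.Negative
  (PinPkg Body HypAt upShift upShift_scheme upShift_a upShift_β upShift_mcrit upShift_Zm)

/-- **Candidate child item `ChiralCornerPinnedExists` of crux stmt-QuantumFields-18066, in the route file's vocabulary**
(statement only; OPEN lattice physics: "the chiral corner of a threshold-pinned Wilson regularisation is its parity-jump
line"). -/
def ChiralCornerPinnedExistsRaw : Prop :=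
  ∀ Nf : ℕ, (Nf = 2 ∨ Nf = 3) → ∀ reg : QCDRegularisation Nf, reg.HasMassScaling →
    (reg.scheme 0 0 0).HasAsymptoticScaling → (∀ᶠ k : ℕ in Filter.atTop, -1 ≤ reg.mcrit k) → ∀ M₀ : ℝ, 0 ≤ M₀ →
    (∀ m : Fin Nf → ℝ, (∀ f, M₀ < m f) → ∃ R : ℝ, 0 < R ∧
      (∀ M : ℝ, M₀ < M → ∀ᶠ k : ℕ in Filter.atTop, ∀ S : ℕ, R ≤ reg.a k * (2 * S + 1) →
        let N : ℕ := 2 * S + 1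
        let mq : Fin Nf → ℝ := fun f => reg.mcrit k + reg.a k * m f / reg.Zm k
        let wt : GaugeConfig 4 N (Matrix.specialUnitaryGroup (Fin 3) ℂ) → ℝ := fun U =>
          ∏ f, ‖fermionDet (wilsonDirac (fundamentalRep (Fin 3)) U (mq f) 1)‖
        (1 / 4 : ℝ) ≤
          (∫ U, (if (fermionDet (wilsonDirac (fundamentalRep (Fin 3)) U
                  (reg.mcrit k - reg.a k * M / reg.Zm k) 1)).re < 0 then (1 : ℝ) else 0) * wt U
              ∂(wilsonMeasure (d := 4) (L := N) (fundamentalRep (Fin 3)) (reg.β k))) /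
            (∫ U, wt U ∂(wilsonMeasure (d := 4) (L := N) (fundamentalRep (Fin 3)) (reg.β k)))) ∧
      (∀ M : ℝ, M₀ < M → ∀ᶠ k : ℕ in Filter.atTop, ∀ S : ℕ, R ≤ reg.a k * (2 * S + 1) →
        reg.a k * (2 * S + 1) ≤ 2 * R →
        let N : ℕ := 2 * S + 1
        let mq : Fin Nf → ℝ := fun f => reg.mcrit k + reg.a k * m f / reg.Zm k
        let wt : GaugeConfig 4 N (Matrix.specialUnitaryGroup (Fin 3) ℂ) → ℝ := fun U =>
          ∏ f, ‖fermionDet (wilsonDirac (fundamentalRep (Fin 3)) U (mq f) 1)‖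
        (∫ U, (if (fermionDet (wilsonDirac (fundamentalRep (Fin 3)) U
                (reg.mcrit k + reg.a k * M / reg.Zm k) 1)).re < 0 then (1 : ℝ) else 0) * wt U
            ∂(wilsonMeasure (d := 4) (L := N) (fundamentalRep (Fin 3)) (reg.β k))) /
          (∫ U, wt U ∂(wilsonMeasure (d := 4) (L := N) (fundamentalRep (Fin 3)) (reg.β k))) ≤ (1 / 8 : ℝ))) →
    (∀ m : Fin Nf → ℝ, (∀ f, M₀ < m f) → ∃ (z shift : QCDField Nf → ℕ → ℝ) (T : OSData (QCDField Nf) 4),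
      IsQCDAlong (reg.scheme m z shift) T ∧ T.IsNontrivial QCDField.glue ∧ T.IsNonGaussian QCDField.glue ∧
        (∀ f g : Fin Nf, f ≠ g → T.IsNontrivial (QCDField.pseudoRe f g)) ∧
          ∃ Δ > 0, T.HasMassGap Δ ∧ (reg.scheme m z shift).HasLatticeMassGap Δ) →
    (∃ δ : ℝ, (∀ ε > (0 : ℝ), ∃ m : Fin Nf → ℝ, (∀ f, 0 < m f) ∧
        ¬ (reg.scheme (fun f => m f + δ) 0 0).HasLatticeMassGap ε) ∧
      ∀ m : Fin Nf → ℝ, (∀ f, 0 < m f) → ∃ (z shift : QCDField Nf → ℕ → ℝ) (T : OSData (QCDField Nf) 4),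
        IsQCDAlong (reg.scheme (fun f => m f + δ) z shift) T ∧ T.IsNontrivial QCDField.glue ∧
          T.IsNonGaussian QCDField.glue ∧ (∀ f g : Fin Nf, f ≠ g → T.IsNontrivial (QCDField.pseudoRe f g)) ∧
            ∃ Δ > 0, T.HasMassGap Δ ∧ (reg.scheme (fun f => m f + δ) z shift).HasLatticeMassGap Δ) →
    ∃ δ : ℝ, (∀ ε > (0 : ℝ), ∃ m : Fin Nf → ℝ, (∀ f, 0 < m f) ∧
        ¬ (reg.scheme (fun f => m f + δ) 0 0).HasLatticeMassGap ε) ∧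
      (∀ m : Fin Nf → ℝ, (∀ f, 0 < m f) → ∃ (z shift : QCDField Nf → ℕ → ℝ) (T : OSData (QCDField Nf) 4),
        IsQCDAlong (reg.scheme (fun f => m f + δ) z shift) T ∧ T.IsNontrivial QCDField.glue ∧
          T.IsNonGaussian QCDField.glue ∧ (∀ f g : Fin Nf, f ≠ g → T.IsNontrivial (QCDField.pseudoRe f g)) ∧
            ∃ Δ > 0, T.HasMassGap Δ ∧ (reg.scheme (fun f => m f + δ) z shift).HasLatticeMassGap Δ) ∧
      ∀ m : Fin Nf → ℝ, (∀ f, 0 < m f) → ∃ R : ℝ, 0 < R ∧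
        (∀ M : ℝ, 0 < M → ∀ᶠ k : ℕ in Filter.atTop, ∀ S : ℕ, R ≤ reg.a k * (2 * S + 1) →
          let N : ℕ := 2 * S + 1
          let mq : Fin Nf → ℝ := fun f => reg.mcrit k + reg.a k * (m f + δ) / reg.Zm k
          let wt : GaugeConfig 4 N (Matrix.specialUnitaryGroup (Fin 3) ℂ) → ℝ := fun U =>
            ∏ f, ‖fermionDet (wilsonDirac (fundamentalRep (Fin 3)) U (mq f) 1)‖
          (1 / 4 : ℝ) ≤
            (∫ U, (if (fermionDet (wilsonDirac (fundamentalRep (Fin 3)) U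
                    (reg.mcrit k + reg.a k * (δ - M) / reg.Zm k) 1)).re < 0 then (1 : ℝ) else 0) * wt U
                ∂(wilsonMeasure (d := 4) (L := N) (fundamentalRep (Fin 3)) (reg.β k))) /
              (∫ U, wt U ∂(wilsonMeasure (d := 4) (L := N) (fundamentalRep (Fin 3)) (reg.β k)))) ∧
        (∀ M : ℝ, 0 < M → ∀ᶠ k : ℕ in Filter.atTop, ∀ S : ℕ, R ≤ reg.a k * (2 * S + 1) →
          reg.a k * (2 * S + 1) ≤ 2 * R →
          let N : ℕ := 2 * S + 1
          let mq : Fin Nf → ℝ := fun f => reg.mcrit k + reg.a k * (m f + δ) / reg.Zm k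
          let wt : GaugeConfig 4 N (Matrix.specialUnitaryGroup (Fin 3) ℂ) → ℝ := fun U =>
            ∏ f, ‖fermionDet (wilsonDirac (fundamentalRep (Fin 3)) U (mq f) 1)‖
          (∫ U, (if (fermionDet (wilsonDirac (fundamentalRep (Fin 3)) U
                  (reg.mcrit k + reg.a k * (δ + M) / reg.Zm k) 1)).re < 0 then (1 : ℝ) else 0) * wt U
              ∂(wilsonMeasure (d := 4) (L := N) (fundamentalRep (Fin 3)) (reg.β k))) /
            (∫ U, wt U ∂(wilsonMeasure (d := 4) (L := N) (fundamentalRep (Fin 3)) (reg.β k))) ≤ (1 / 8 : ℝ))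

/-! ## The raw pin clauses at the corner are the pin clauses of the up-shift at zero threshold -/

/-- The lower pin at the corner `δ`, raw masses, IS `PinClause Nf (upShift reg δ) 0 m R`. [folklore] -/
theorem pinClause_upShift_zero_iff_raw {Nf : ℕ} (reg : QCDRegularisation Nf) (δ : ℝ) (m : Fin Nf → ℝ) (R : ℝ) :
    PinClause Nf (upShift reg δ) 0 m R ↔
      (∀ M : ℝ, 0 < M → ∀ᶠ k : ℕ in Filter.atTop, ∀ S : ℕ, R ≤ reg.a k * (2 * S + 1) →
        let N : ℕ := 2 * S + 1
        let mq : Fin Nf → ℝ := fun f => reg.mcrit k + reg.a k * (m f + δ) / reg.Zm k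
        let wt : GaugeConfig 4 N (Matrix.specialUnitaryGroup (Fin 3) ℂ) → ℝ := fun U =>
          ∏ f, ‖fermionDet (wilsonDirac (fundamentalRep (Fin 3)) U (mq f) 1)‖
        (1 / 4 : ℝ) ≤
          (∫ U, (if (fermionDet (wilsonDirac (fundamentalRep (Fin 3)) U
                  (reg.mcrit k + reg.a k * (δ - M) / reg.Zm k) 1)).re < 0 then (1 : ℝ) else 0) * wt U
              ∂(wilsonMeasure (d := 4) (L := N) (fundamentalRep (Fin 3)) (reg.β k))) /
            (∫ U, wt U ∂(wilsonMeasure (d := 4) (L := N) (fundamentalRep (Fin 3)) (reg.β k)))) := by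
  have h1 : ∀ k M, reg.mcrit k + reg.a k * δ / reg.Zm k - reg.a k * M / reg.Zm k =
      reg.mcrit k + reg.a k * (δ - M) / reg.Zm k := fun k M => by ring
  have h2 : ∀ (k) (f : Fin Nf), reg.mcrit k + reg.a k * δ / reg.Zm k + reg.a k * m f / reg.Zm k =
      reg.mcrit k + reg.a k * (m f + δ) / reg.Zm k := fun k f => by ring
  simp only [PinClause, upShift_a, upShift_β, upShift_mcrit, upShift_Zm, h1, h2]

/-- The upper pin at the corner `δ`, raw masses, IS `UpperPin Nf (upShift reg δ) 0 m R`. [folklore] -/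
theorem upperPin_upShift_zero_iff_raw {Nf : ℕ} (reg : QCDRegularisation Nf) (δ : ℝ) (m : Fin Nf → ℝ) (R : ℝ) :
    UpperPin Nf (upShift reg δ) 0 m R ↔
      (∀ M : ℝ, 0 < M → ∀ᶠ k : ℕ in Filter.atTop, ∀ S : ℕ, R ≤ reg.a k * (2 * S + 1) →
        reg.a k * (2 * S + 1) ≤ 2 * R →
        let N : ℕ := 2 * S + 1
        let mq : Fin Nf → ℝ := fun f => reg.mcrit k + reg.a k * (m f + δ) / reg.Zm k
        let wt : GaugeConfig 4 N (Matrix.specialUnitaryGroup (Fin 3) ℂ) → ℝ := fun U =>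
          ∏ f, ‖fermionDet (wilsonDirac (fundamentalRep (Fin 3)) U (mq f) 1)‖
        (∫ U, (if (fermionDet (wilsonDirac (fundamentalRep (Fin 3)) U
                (reg.mcrit k + reg.a k * (δ + M) / reg.Zm k) 1)).re < 0 then (1 : ℝ) else 0) * wt U
            ∂(wilsonMeasure (d := 4) (L := N) (fundamentalRep (Fin 3)) (reg.β k))) /
          (∫ U, wt U ∂(wilsonMeasure (d := 4) (L := N) (fundamentalRep (Fin 3)) (reg.β k))) ≤ (1 / 8 : ℝ)) := by
  have h1 : ∀ k M, reg.mcrit k + reg.a k * δ / reg.Zm k + reg.a k * M / reg.Zm k =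
      reg.mcrit k + reg.a k * (δ + M) / reg.Zm k := fun k M => by ring
  have h2 : ∀ (k) (f : Fin Nf), reg.mcrit k + reg.a k * δ / reg.Zm k + reg.a k * m f / reg.Zm k =
      reg.mcrit k + reg.a k * (m f + δ) / reg.Zm k := fun k f => by ring
  simp only [UpperPin, upShift_a, upShift_β, upShift_mcrit, upShift_Zm, h2]
  simp only [h1]

/-- Chirality at zero of the up-shift IS chirality at zero of the δ-re-pinned schemes (item 17661's wording). [folklore] -/
theorem isChiralAtZero_upShift_iff_addConst {Nf : ℕ} (reg : QCDRegularisation Nf) (δ : ℝ) :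
    (upShift reg δ).IsChiralAtZero ↔
      ∀ ε > (0 : ℝ), ∃ m : Fin Nf → ℝ, (∀ f, 0 < m f) ∧ ¬ (reg.scheme (fun f => m f + δ) 0 0).HasLatticeMassGap ε := by
  simp only [QCDRegularisation.IsChiralAtZero, scheme_addConst_eq_upShift_scheme]

/-- The body of the up-shift above `0` IS the body of the δ-re-pinned schemes at every positive tuple (17661's wording). [folklore] -/
theorem body_upShift_zero_iff_addConst {Nf : ℕ} (reg : QCDRegularisation Nf) (δ : ℝ) :
    Body Nf (upShift reg δ) 0 ↔
      ∀ m : Fin Nf → ℝ, (∀ f, 0 < m f) → ∃ (z shift : QCDField Nf → ℕ → ℝ) (T : OSData (QCDField Nf) 4),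
        IsQCDAlong (reg.scheme (fun f => m f + δ) z shift) T ∧ T.IsNontrivial QCDField.glue ∧
          T.IsNonGaussian QCDField.glue ∧ (∀ f g : Fin Nf, f ≠ g → T.IsNontrivial (QCDField.pseudoRe f g)) ∧
            ∃ Δ > 0, T.HasMassGap Δ ∧ (reg.scheme (fun f => m f + δ) z shift).HasLatticeMassGap Δ := by
  simp only [Body, scheme_addConst_eq_upShift_scheme]

/-- The zero-threshold pin package of the up-shift IS the raw pin at the corner. [folklore] -/
theorem pinPkg_upShift_zero_iff_raw {Nf : ℕ} (reg : QCDRegularisation Nf) (δ : ℝ) :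
    PinPkg Nf (upShift reg δ) 0 ↔
      ∀ m : Fin Nf → ℝ, (∀ f, 0 < m f) → ∃ R : ℝ, 0 < R ∧
        (∀ M : ℝ, 0 < M → ∀ᶠ k : ℕ in Filter.atTop, ∀ S : ℕ, R ≤ reg.a k * (2 * S + 1) →
          let N : ℕ := 2 * S + 1
          let mq : Fin Nf → ℝ := fun f => reg.mcrit k + reg.a k * (m f + δ) / reg.Zm k
          let wt : GaugeConfig 4 N (Matrix.specialUnitaryGroup (Fin 3) ℂ) → ℝ := fun U =>
            ∏ f, ‖fermionDet (wilsonDirac (fundamentalRep (Fin 3)) U (mq f) 1)‖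
          (1 / 4 : ℝ) ≤
            (∫ U, (if (fermionDet (wilsonDirac (fundamentalRep (Fin 3)) U
                    (reg.mcrit k + reg.a k * (δ - M) / reg.Zm k) 1)).re < 0 then (1 : ℝ) else 0) * wt U
                ∂(wilsonMeasure (d := 4) (L := N) (fundamentalRep (Fin 3)) (reg.β k))) /
              (∫ U, wt U ∂(wilsonMeasure (d := 4) (L := N) (fundamentalRep (Fin 3)) (reg.β k)))) ∧
        (∀ M : ℝ, 0 < M → ∀ᶠ k : ℕ in Filter.atTop, ∀ S : ℕ, R ≤ reg.a k * (2 * S + 1) →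
          reg.a k * (2 * S + 1) ≤ 2 * R →
          let N : ℕ := 2 * S + 1
          let mq : Fin Nf → ℝ := fun f => reg.mcrit k + reg.a k * (m f + δ) / reg.Zm k
          let wt : GaugeConfig 4 N (Matrix.specialUnitaryGroup (Fin 3) ℂ) → ℝ := fun U =>
            ∏ f, ‖fermionDet (wilsonDirac (fundamentalRep (Fin 3)) U (mq f) 1)‖
          (∫ U, (if (fermionDet (wilsonDirac (fundamentalRep (Fin 3)) U
                  (reg.mcrit k + reg.a k * (δ + M) / reg.Zm k) 1)).re < 0 then (1 : ℝ) else 0) * wt U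
              ∂(wilsonMeasure (d := 4) (L := N) (fundamentalRep (Fin 3)) (reg.β k))) /
            (∫ U, wt U ∂(wilsonMeasure (d := 4) (L := N) (fundamentalRep (Fin 3)) (reg.β k))) ≤ (1 / 8 : ℝ)) := by
  simp only [PinPkg, pinClause_upShift_zero_iff_raw, upperPin_upShift_zero_iff_raw]

/-- **The raw child IS the registered stub `stub_chiralCornerPinnedExists`** (hypotheses 1–6 are `HypAt` unfolded; the two
corner clauses are item 17661's wording of `IsChiralAtZero`/`Body` of the up-shift; the conclusion's pin is `PinPkg … 0` of
the up-shift with the bare masses re-bracketed). [folklore] -/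
theorem chiralCornerPinnedExistsRaw_iff_stub :
    ChiralCornerPinnedExistsRaw ↔
      ∀ Nf : ℕ, (Nf = 2 ∨ Nf = 3) → ∀ (reg : QCDRegularisation Nf) (M₀ : ℝ), HypAt Nf reg M₀ →
        (∃ δ : ℝ, (upShift reg δ).IsChiralAtZero ∧ Body Nf (upShift reg δ) 0) →
        ∃ δ : ℝ, (upShift reg δ).IsChiralAtZero ∧ Body Nf (upShift reg δ) 0 ∧ PinPkg Nf (upShift reg δ) 0 := by
  simp only [isChiralAtZero_upShift_iff_addConst, body_upShift_zero_iff_addConst, pinPkg_upShift_zero_iff_raw]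
  simp only [ChiralCornerPinnedExistsRaw, HypAt, PinPkg, Body, PinClause, UpperPin, and_imp]
  -- the two sides now differ only in the position of the binder `∀ M₀` (crux order vs `HypAt` order)
  constructor
  · intro h Nf hNf reg M₀ hMS hAS hbr hM₀ hpin hbody
    exact h Nf hNf reg hMS hAS hbr M₀ hM₀ hpin hbody
  · intro h Nf hNf reg hMS hAS hbr M₀ hM₀ hpin hbody
    exact h Nf hNf reg M₀ hMS hAS hbr hM₀ hpin hbody

end Summit.QuantumFields.QCD.Theorems.LightQuarkJumpLine

end
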